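import Mathlib
import Summits.QuantumFields.BalabanUV.Beta.DecouplingResummation110

/-!
# [Balaban1988RG2Cluster] (1.8) = (1.9) pp. 3–4: the DECOUPLING EXPANSION (multivariate fundamental theorem of calculus)
# KERNEL-CHECKED in the Cauchy representation (1.23) — one factor `∫₀¹ds(Δ) (2πi)⁻¹∮dσ(Δ)∕(σ(Δ) − s(Δ))²` of the tree's
# `B13Sect1Arith.cauchyOp` IS the difference `s(Δ) = 1` minus `s(Δ) = 0`, the iterated operation IS the iterated
# difference, and the sum over `σ ⊆ σ₀` TELESCOPES to the value at `s = 1`; with the sibling's resummation: (1.8) = (1.10)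
# (cell topic `Summits/QuantumFields/BalabanUV/Beta`; row-D4 terminal leaf (T4)(b), caveat C1)

HONEST FRAMING (cell rule).  Discharging `BetaPertH` makes Bałaban's UV stability UNCONDITIONAL — a real
constructive-QFT result; NOT the continuum limit, NOT the Clay problem.  This module discharges NOTHING of `BetaPertH`.
It is the row-D4 owner's kernel form of the step (1.8) → (1.9) of [II] pp. 3–4 (*"Now, as in cluster expansions, we
apply the fundamental theorem of calculus"*; class «P (multivariate FTC, exact)» in the b13∕r2 census `CENSUS-B13-v2.md`
row p. 4) IN THE REPRESENTATION (1.23) by which the tree models the terms (`B13Sect1Arith.cauchyOp`, pv20-g2, whose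
header records *"Cauchy's integral formula itself (that (1.23) EQUALS the s-derivatives of (1.10)) — [folklore], not
typed"* — supplied here in the form that (1.9)–(1.10) actually use: the `σ`-terms are ITERATED DIFFERENCES and their sum
over `σ ⊆ σ₀` is the value at `s = 1`).  [folklore] one-variable complex analysis (Mathlib's Cauchy formula for the
derivative + the fundamental theorem of calculus on `[0, 1]`) + finite-difference algebra; composed BY NAME with the
sibling `DecouplingResummation110` (p204386).  NOT summit progress.  Unit `b2b-balaban-beta-an4-g34` (owner of
`BINDER-OWNERS.md` row D4); cell `GAPS.md` C-an4-67.

CITATION HEADER (lean-in-tree rule).  [II] = T. Bałaban, *Renormalization group approach to lattice gauge field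
theories. II. Cluster expansions*, Commun. Math. Phys. **116**, 1–22 (1988) [Balaban1988RG2Cluster] (journal page =
PDF page; renders `HOME/b2b-balaban-ref1/pages/1988-cmp116-rg-II-cluster/…-p003-x2.png`, `…-p004-x2.png`,
`…-p006-x2.png`, `…-p007-x2.png`, `…-p010-x2.png`, READ AS IMAGES by this unit).  WHAT IS REPRODUCED — p. 3 [PDF 3],
verbatim: *"This way the s-dependent propagators H(s), G̃(s), H₀(s) are defined. They coincide with the original ones for
s = 1."* and (1.8) `E(□₀,𝐔,(tζ̃_□ + t_□ζ_□)𝐇_k(𝐔,𝐉,B′)) = E(□₀,𝐔,(tζ̃_□ + t_□ζ_□)𝐇_k(𝐔,𝐉,H(s),G̃(s),H₀(s)B′))|_{s=1}`;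
p. 4 [PDF 4], verbatim: *"To simplify the formulas let us omit the symbols 𝐔, 𝐉. Now, as in cluster expansions, we apply
the fundamental theorem of calculus"* (1.9)
`E(□₀,(tζ̃_□ + t_□ζ_□)𝐇_k(B′)) = Σ_{σ⊂σ₀} ∏_{Δ∈σ} ∫₀¹ ds(Δ) ∂∕∂s(Δ) E(□₀,(tζ̃_□ + t_□ζ_□)𝐇_k(H(s), G̃(s), H₀(s)B′))|_{s(σᶜ)=0}`;
p. 7 (1.23) (quoted in full in the sibling's header): the term of a domain `Y₀` is
`(1∕2πi)∫dt_□∕t_□² ∏_{Δ⊂Y₀∖□̃⁴} ∫ds(Δ) (1∕2πi)∫ dσ(Δ)∕(σ(Δ) − s(Δ))² · E(□₀,(tζ̃_□ + t_□ζ_□)𝐇_k(σ(Y₀), B′))`, *"the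
σ(Δ)-integrations are over the circles |σ(Δ)| = e^{κ₁}"*; analyticity in the decoupling variables — p. 6 after (1.20):
*"𝐇_k(s(Y₀), B′)) is an analytic function of s(Y₀), B, for |s(Y₀)| ≦ e^{κ₁} and g_k|B| < ε₁"*, p. 10 after (1.38):
*"The underintegral expression is analytic in σ(Y) on the polydisc |σ(Y)| ≦ e^{κ₁}."*

WHAT IS CERTIFIED HERE (kernel, sorry-free; [folklore]).
§1 ONE FACTOR: for `G` holomorphic on an open `U ⊇ {|z| ≤ ρ}`, `ρ > 1`,
   `∫₀¹ du (2πi)⁻¹ ∮_{|z|=ρ} G(z) dz∕(z − u)² = G(1) − G(0)` (`integral_cauchy_eq_sub`: Mathlib's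
   `Complex.two_pi_I_inv_smul_circleIntegral_sub_sq_inv_smul_of_differentiable` — the circle integral IS `G′(u)` for
   `|u| < ρ` — then `intervalIntegral.integral_eq_sub_of_hasDerivAt` along `[0,1] ⊂ ℝ ⊂ ℂ`).
§2 ITERATION: the iterated difference `diffList l F` (`D_{i::l}F(σ) = D_lF(σ[i↦1]) − D_lF(σ[i↦0])`) is invariant under
   permutations of the list (`diffList_perm` — difference operators commute), whence `diffSet S F` for a finite set and
   `diffSet_insert`; the TELESCOPING IDENTITY `sum_powerset_diffSet`: at a base point vanishing on `S`,
   `Σ_{σ⊆S} D_σ F = F(s ↦ 1 on S)` (pure algebra, any additive group); and **`cauchyOp_eq_diffList`**: for `F` separately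
   holomorphic on the polydomain `U^ι` in every listed coordinate (`l` without repetitions), at every base vector with
   coordinates in `U`, `cauchyOp ρ l F s σ = D_l F σ` — by induction on the list through §1, with
   `differentiableOn_diffList` supplying the holomorphy of the inner iterated differences (no Fubini is used: the
   printed `∏` is the ordered iteration, as in `B13Sect1Arith`).
§3 THE END: `SepHolNear F σ₀ U` (the printed polydisc analyticity, as separate holomorphy on `U^{Pt d}` in each
   decoupling variable of `σ₀`); `term19_eq_diffSet` (the sibling's `σ`-term `term19 ρ F σ` IS `D_σ F(0)`);
   **`eq_sum_term19`**: `F(1 on σ₀, 0 elsewhere) = Σ_{σ⊆σ₀} term19 ρ F σ` — (1.8) = (1.9); and, composed with the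
   sibling's `sum_term19_eq_sum_connected` under its support hypothesis, **`eq_sum_term19_connected`**:
   `F(1 on σ₀) = Σ_{σ⊆σ₀, □̃⁴∪⋃σ connected} term19 ρ F σ` — (1.8) = (1.10), the decoupling expansion over connected
   domains as ONE kernel identity in the cell's model of the terms.

NOT CLAIMED (located, by name).  That Bałaban's integrand `E(□₀,(tζ̃_□ + t_□ζ_□)𝐇_k(H(s), G̃(s), H₀(s)B′))` IS separately
holomorphic on a neighbourhood of the closed polydisc `|σ(Δ)| ≤ e^{κ₁}` (the p. 6 sentence above — rows (1.11)–(1.21) of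
[II] §1, the b13∕pv20 censuses; for the `𝐏^{(k)}` terms p. 10) — it is the HYPOTHESIS `SepHolNear`; the support
hypothesis (the sibling modules); the `t_□`-circle and every BOUND ((1.24): `B13Sect1Arith.bound_124`); the dictionary to
Bałaban's objects; NOT summit progress.  MODEL CONVENTIONS: as in the siblings — parameters indexed by `Pt d`, the
unlisted ones frozen at `0` («s(σᶜ) = 0»; «s = 1» = `1` on `σ₀`, `0` elsewhere, the cubes of `□̃⁴` carrying no
parameter in print); `U` an open neighbourhood of the closed disc of radius `ρ` (print: analytic on the closed polydisc
— read as analytic on a neighbourhood, the standing reading of `B13Sect1Arith`'s circles `|σ(Δ)| = e^{κ₁}`); `E` complete.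
-/

namespace Summit.QuantumFields.BalabanUV.Beta.DecouplingExpansion19

open Literature.MathematicalPhysics.QuantumFieldTheory.Balaban1983to89.B13Sect1Arith (cauchyOp)
open Literature.MathematicalPhysics.QuantumFieldTheory.Balaban1983to89.B14DomainGeom (Pt)
open Literature.MathematicalPhysics.QuantumFieldTheory.Balaban1983to89.B13Factor210 (WallConnected)
open Summit.QuantumFields.BalabanUV.Beta.DecouplingResummation110 (term19 SupportedOnRootComp
  sum_term19_eq_sum_connected)
open Complex Metric Set

noncomputable section

/-! ## §1 One factor of (1.23) IS `∫₀¹ ds ∂∕∂s`: `∫₀¹du (2πi)⁻¹∮ G(z)dz∕(z − u)² = G(1) − G(0)` -/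

section OneVariable

variable {E : Type*} [NormedAddCommGroup E] [NormedSpace ℂ E] [CompleteSpace E]

/-- **ONE DECOUPLING FACTOR** of (1.23) evaluated: for `G` holomorphic on a neighbourhood of the closed disc `|z| ≤ ρ`,
`ρ > 1`, `∫₀¹ du (2πi)⁻¹ ∮_{|z|=ρ} G(z) dz∕(z − u)² = G(1) − G(0)` — the Cauchy formula for the derivative (Mathlib
`Complex.two_pi_I_inv_smul_circleIntegral_sub_sq_inv_smul_of_differentiable`) followed by the fundamental theorem of
calculus on `[0, 1]`; i.e. the operation `∫₀¹ ds(Δ) ∂∕∂s(Δ)` of (1.9) in the representation (1.23) is the DIFFERENCE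
`s(Δ) = 1` minus `s(Δ) = 0`. [folklore] -/
theorem integral_cauchy_eq_sub {ρ : ℝ} (hρ : 1 < ρ) {U : Set ℂ} (hU : IsOpen U) (hsub : closedBall (0 : ℂ) ρ ⊆ U)
    {G : ℂ → E} (hG : DifferentiableOn ℂ G U) :
    ∫ u in (0:ℝ)..1, (2 * Real.pi * I : ℂ)⁻¹ • ∮ z in C(0, ρ), ((z - (u : ℂ)) ^ 2)⁻¹ • G z = G 1 - G 0 := by
  have hball : ∀ u ∈ uIcc (0:ℝ) 1, ((u : ℝ) : ℂ) ∈ ball (0 : ℂ) ρ := by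
    intro u hu
    rw [uIcc_of_le zero_le_one] at hu
    rw [mem_ball, dist_zero_right, norm_real, Real.norm_eq_abs, abs_of_nonneg hu.1]
    exact lt_of_le_of_lt hu.2 hρ
  have hderiv : ∀ u ∈ uIcc (0:ℝ) 1,
      (2 * Real.pi * I : ℂ)⁻¹ • ∮ z in C(0, ρ), ((z - (u : ℂ)) ^ 2)⁻¹ • G z = deriv G u := fun u hu =>
    Complex.two_pi_I_inv_smul_circleIntegral_sub_sq_inv_smul_of_differentiable hU hsub hG (hball u hu)
  rw [intervalIntegral.integral_congr hderiv]
  have hUnhds : ∀ u ∈ uIcc (0:ℝ) 1, U ∈ nhds ((u : ℝ) : ℂ) := fun u hu =>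
    hU.mem_nhds (hsub (ball_subset_closedBall (hball u hu)))
  have hd : ∀ u ∈ uIcc (0:ℝ) 1, HasDerivAt (fun y : ℝ => G (y : ℂ)) (deriv G u) u := fun u hu => by
    have h := ((hG.differentiableAt (hUnhds u hu)).hasDerivAt).scomp u ofRealCLM.hasDerivAt
    simpa [Function.comp_def, ofRealCLM_apply] using h
  have hcont : ContinuousOn (fun u : ℝ => deriv G (u : ℂ)) (uIcc (0:ℝ) 1) := by
    have hc : ContinuousOn (deriv G) U :=
      (hG.analyticOnNhd hU).deriv.continuousOn
    refine hc.comp continuous_ofReal.continuousOn fun u hu => ?_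
    exact hsub (ball_subset_closedBall (hball u hu))
  have := intervalIntegral.integral_eq_sub_of_hasDerivAt hd (hcont.intervalIntegrable)
  simpa using this

end OneVariable

/-! ## §2 The iterated Cauchy operation IS the iterated difference `∏_Δ (s(Δ)=1 − s(Δ)=0)` -/

section Differences

variable {ι : Type*} [DecidableEq ι] {E : Type*}

section Algebra

variable [AddCommGroup E]

/-- The ITERATED DIFFERENCE over a list of coordinates: `D_{[]} F = F`,
`D_{i :: l} F (σ) = D_l F (σ[i ↦ 1]) − D_l F (σ[i ↦ 0])`. [folklore] -/
def diffList : List ι → ((ι → ℂ) → E) → (ι → ℂ) → E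
  | [], F => F
  | i :: l, F => fun σ => diffList l F (Function.update σ i 1) - diffList l F (Function.update σ i 0)

/-- Difference operators in distinct (indeed any) coordinates commute; hence the iterated difference depends on the
list only up to permutation. [folklore] -/
theorem diffList_perm {l l' : List ι} (hp : l.Perm l') (F : (ι → ℂ) → E) : diffList l F = diffList l' F := by
  induction hp generalizing F with
  | nil => rfl
  | cons i _ ih =>
    funext σ
    simp only [diffList, ih]
  | swap i j l =>
    funext σ
    by_cases hij : i = j
    · subst hij; rfl
    · simp only [diffList, Function.update_comm hij]
      abel
  | trans _ _ ih₁ ih₂ => rw [ih₁, ih₂]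

/-- The iterated difference over a FINITE SET of coordinates (well defined by `diffList_perm`). [folklore] -/
def diffSet (S : Finset ι) (F : (ι → ℂ) → E) : (ι → ℂ) → E := diffList S.toList F

/-- Peeling one coordinate off the iterated difference. [folklore] -/
theorem diffSet_insert {i : ι} {S : Finset ι} (hi : i ∉ S) (F : (ι → ℂ) → E) (σ : ι → ℂ) :
    diffSet (insert i S) F σ = diffSet S F (Function.update σ i 1) - diffSet S F (Function.update σ i 0) := by
  unfold diffSet
  rw [diffList_perm (Finset.toList_insert hi) F]
  rfl

/-- Setting the coordinates in `S` to `1`. [folklore] -/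
def setOne (S : Finset ι) (σ : ι → ℂ) : ι → ℂ := fun j => if j ∈ S then 1 else σ j

omit [AddCommGroup E] in
/-- [folklore] -/
theorem setOne_empty (σ : ι → ℂ) : setOne (∅ : Finset ι) σ = σ := by
  funext j; simp [setOne]

omit [AddCommGroup E] in
/-- [folklore] -/
theorem setOne_insert (i : ι) (S : Finset ι) (σ : ι → ℂ) :
    setOne (insert i S) σ = setOne S (Function.update σ i 1) := by
  funext j
  by_cases hj : j = i
  · subst hj; simp [setOne]
  · simp [setOne, hj]

/-- **THE MULTIVARIATE FUNDAMENTAL THEOREM OF CALCULUS IN DIFFERENCE FORM** (the algebra of (1.9)): at a base point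
vanishing on `S` («s(σᶜ) = 0»), the sum over all `σ ⊆ S` of the iterated differences over `σ` telescopes to the value
with all coordinates of `S` set to `1` («s = 1», (1.8)). [folklore] -/
theorem sum_powerset_diffSet (F : (ι → ℂ) → E) :
    ∀ (S : Finset ι) (τ : ι → ℂ), (∀ j ∈ S, τ j = 0) → ∑ σ ∈ S.powerset, diffSet σ F τ = F (setOne S τ) := by
  intro S
  induction S using Finset.induction_on with
  | empty =>
    intro τ _
    simp [diffSet, diffList, setOne_empty]
  | insert i S hi ih =>
    intro τ hτ
    have hτi : τ i = 0 := hτ i (Finset.mem_insert_self i S)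
    have hτS : ∀ j ∈ S, τ j = 0 := fun j hj => hτ j (Finset.mem_insert_of_mem hj)
    have h1 : ∀ j ∈ S, Function.update τ i 1 j = 0 := fun j hj => by
      have hne : j ≠ i := by rintro rfl; exact hi hj
      rw [Function.update_of_ne hne]; exact hτS j hj
    have h0 : Function.update τ i 0 = τ := by
      rw [← hτi, Function.update_eq_self]
    have hB : ∑ σ ∈ S.powerset, diffSet (insert i σ) F τ
        = ∑ σ ∈ S.powerset, (diffSet σ F (Function.update τ i 1) - diffSet σ F (Function.update τ i 0)) :=
      Finset.sum_congr rfl fun σ hσ => diffSet_insert (fun h => hi (Finset.mem_powerset.1 hσ h)) F τ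
    rw [Finset.sum_powerset_insert hi, hB, Finset.sum_sub_distrib, h0, ih τ hτS, ih _ h1, setOne_insert]
    abel

end Algebra

variable [NormedAddCommGroup E] [NormedSpace ℂ E] [CompleteSpace E]

omit [CompleteSpace E] in
/-- Separate holomorphy in the coordinate `i` on the polydomain `U^ι` (for every base vector with all coordinates in
`U`) is inherited by the iterated differences over coordinates other than `i` (`0, 1 ∈ U`). [folklore] -/
theorem differentiableOn_diffList {U : Set ℂ} (h0 : (0 : ℂ) ∈ U) (h1 : (1 : ℂ) ∈ U) {F : (ι → ℂ) → E} {i : ι}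
    (hF : ∀ σ : ι → ℂ, (∀ j, σ j ∈ U) → DifferentiableOn ℂ (fun z => F (Function.update σ i z)) U) :
    ∀ (l : List ι), i ∉ l → ∀ σ : ι → ℂ, (∀ j, σ j ∈ U) →
      DifferentiableOn ℂ (fun z => diffList l F (Function.update σ i z)) U
  | [], _, σ, hσ => by simpa [diffList] using hF σ hσ
  | j :: l, hil, σ, hσ => by
    have hij : i ≠ j := fun h => hil (h ▸ List.mem_cons_self)
    have hil' : i ∉ l := fun h => hil (List.mem_cons_of_mem j h)
    simp only [diffList]
    have e1 : ∀ z : ℂ, Function.update (Function.update σ i z) j (1:ℂ)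
        = Function.update (Function.update σ j 1) i z := fun z => Function.update_comm hij z 1 σ
    have e0 : ∀ z : ℂ, Function.update (Function.update σ i z) j (0:ℂ)
        = Function.update (Function.update σ j 0) i z := fun z => Function.update_comm hij z 0 σ
    have hσ1 : ∀ j', Function.update σ j (1:ℂ) j' ∈ U := fun j' => by
      by_cases h : j' = j
      · subst h; simpa using h1
      · rw [Function.update_of_ne h]; exact hσ j'
    have hσ0 : ∀ j', Function.update σ j (0:ℂ) j' ∈ U := fun j' => by
      by_cases h : j' = j
      · subst h; simpa using h0
      · rw [Function.update_of_ne h]; exact hσ j'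
    simp only [e1, e0]
    exact (differentiableOn_diffList h0 h1 hF l hil' _ hσ1).sub (differentiableOn_diffList h0 h1 hF l hil' _ hσ0)

/-- **THE ITERATED CAUCHY OPERATION IS THE ITERATED DIFFERENCE**: for an integrand separately holomorphic on the
polydomain `U^ι`, `U` open `⊇ {|z| ≤ ρ}`, `ρ > 1`, in every listed coordinate, `cauchyOp ρ l F s σ = D_l F σ` at every
base vector with coordinates in `U` — the representation (1.23) of `∏_{Δ∈l} ∫₀¹ ds(Δ) ∂∕∂s(Δ)` computes exactly the
product of the differences `s(Δ)=1` minus `s(Δ)=0` (no Fubini: the print's ordered iteration, induction on the list).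
[folklore] -/
theorem cauchyOp_eq_diffList {ρ : ℝ} (hρ : 1 < ρ) {U : Set ℂ} (hU : IsOpen U) (hsub : closedBall (0 : ℂ) ρ ⊆ U)
    {F : (ι → ℂ) → E} :
    ∀ (l : List ι), l.Nodup →
      (∀ i ∈ l, ∀ σ : ι → ℂ, (∀ j, σ j ∈ U) → DifferentiableOn ℂ (fun z => F (Function.update σ i z)) U) →
      ∀ (s : ι → ℝ) (σ : ι → ℂ), (∀ j, σ j ∈ U) → cauchyOp ρ l (fun _ τ => F τ) s σ = diffList l F σ
  | [], _, _, s, σ, _ => by simp [cauchyOp, diffList]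
  | i :: l, hnd, hF, s, σ, hσ => by
    have h0 : (0 : ℂ) ∈ U := hsub (by simpa using (zero_le_one.trans hρ.le))
    have h1 : (1 : ℂ) ∈ U := hsub (by simpa using hρ.le)
    have hil : i ∉ l := (List.nodup_cons.1 hnd).1
    have IH := cauchyOp_eq_diffList hρ hU hsub l (List.nodup_cons.1 hnd).2
      (fun j hj => hF j (List.mem_cons_of_mem i hj))
    have hupd : ∀ z ∈ closedBall (0 : ℂ) ρ, ∀ j, Function.update σ i z j ∈ U := fun z hz j => by
      by_cases h : j = i
      · subst h; simpa using hsub hz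
      · rw [Function.update_of_ne h]; exact hσ j
    have hcongr : ∀ u : ℝ,
        (∮ z in C(0, ρ), ((z - (u : ℂ)) ^ 2)⁻¹ • cauchyOp ρ l (fun _ τ => F τ) (Function.update s i u)
          (Function.update σ i z))
        = ∮ z in C(0, ρ), ((z - (u : ℂ)) ^ 2)⁻¹ • diffList l F (Function.update σ i z) := fun u => by
      refine circleIntegral.integral_congr (zero_le_one.trans hρ.le) fun z hz => ?_
      have hz' : z ∈ closedBall (0 : ℂ) ρ := sphere_subset_closedBall hz
      simp only [IH _ _ (hupd z hz')]
    simp only [cauchyOp, diffList, hcongr]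
    exact integral_cauchy_eq_sub hρ hU hsub
      (differentiableOn_diffList h0 h1 (hF i List.mem_cons_self) l hil σ hσ)

end Differences

/-! ## §3 END: (1.8) = (1.9) = (1.10) for the terms `term19` -/

section End19

variable {d : ℕ} {E : Type*} [NormedAddCommGroup E] [NormedSpace ℂ E] [CompleteSpace E]

/-- SEPARATE HOLOMORPHY of the integrand on the polydomain `U^{Pt d}`, `U` open `⊇ {|z| ≤ ρ}`: in each decoupling
variable of `σ₀`, for every base vector with all coordinates in `U`, `F` is holomorphic on `U` ([II] p. 10: *"The
underintegral expression is analytic in σ(Y) on the polydisc |σ(Y)| ≦ e^{κ₁}"*; p. 6 after (1.20): *"𝐇_k(s(Y₀), B′))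
is an analytic function of s(Y₀), B, for |s(Y₀)| ≦ e^{κ₁} and g_k|B| < ε₁"*). [cite: Balaban1988RG2Cluster, (1.38) p.10] -/
def SepHolNear (F : (Pt d → ℂ) → E) (σ₀ : Finset (Pt d)) (U : Set ℂ) : Prop :=
  ∀ i ∈ σ₀, ∀ σ : Pt d → ℂ, (∀ j, σ j ∈ U) → DifferentiableOn ℂ (fun z => F (Function.update σ i z)) U

/-- The `σ`-term of (1.9) in the representation (1.23) IS the iterated difference of `F` over the cubes of `σ` at the
base point `0`. [folklore] -/
theorem term19_eq_diffSet {ρ : ℝ} (hρ : 1 < ρ) {U : Set ℂ} (hU : IsOpen U) (hsub : closedBall (0 : ℂ) ρ ⊆ U)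
    {F : (Pt d → ℂ) → E} {σ₀ σ : Finset (Pt d)} (hF : SepHolNear F σ₀ U) (hσ : σ ⊆ σ₀) :
    term19 ρ F σ = diffSet σ F 0 :=
  cauchyOp_eq_diffList hρ hU hsub σ.toList (Finset.nodup_toList σ)
    (fun i hi τ hτ => hF i (hσ (Finset.mem_toList.1 hi)) τ hτ) 0 0
    (fun _ => hsub (by simpa using (zero_le_one.trans hρ.le)))

/-- **(1.8) = (1.9)** ([II] pp. 3–4, KERNEL FORM in the representation (1.23)): the value of the integrand at `s = 1`
on all cubes of `σ₀` (and `0` elsewhere) EQUALS the sum over all `σ ⊆ σ₀` of the `σ`-terms —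
*"E(…𝐇_k(𝐔,𝐉,B′)) = E(…𝐇_k(𝐔,𝐉,H(s),G̃(s),H₀(s)B′))|_{s=1}. (1.8) … Now, as in cluster expansions, we apply the
fundamental theorem of calculus"* (1.9). [cite: Balaban1988RG2Cluster, (1.8)–(1.9) pp.3–4] -/
theorem eq_sum_term19 {ρ : ℝ} (hρ : 1 < ρ) {U : Set ℂ} (hU : IsOpen U) (hsub : closedBall (0 : ℂ) ρ ⊆ U)
    {F : (Pt d → ℂ) → E} {σ₀ : Finset (Pt d)} (hF : SepHolNear F σ₀ U) :
    F (setOne σ₀ 0) = ∑ σ ∈ σ₀.powerset, term19 ρ F σ := by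
  rw [← sum_powerset_diffSet F σ₀ 0 (fun _ _ => rfl)]
  exact Finset.sum_congr rfl fun σ hσ => (term19_eq_diffSet hρ hU hsub hF (Finset.mem_powerset.1 hσ)).symm

open Classical in
/-- **(1.8) = (1.10)** — THE DECOUPLING EXPANSION OVER CONNECTED DOMAINS, composed BY NAME with the sibling's
resummation `sum_term19_eq_sum_connected`: under separate holomorphy near the closed polydisc and the support
hypothesis of [II] p. 4, the integrand at `s = 1` equals the sum of its `σ`-terms over the CONNECTED domains
`Y₀ = □̃⁴ ∪ ⋃σ ⊇ □̃⁴`. [cite: Balaban1988RG2Cluster, (1.8)–(1.10) pp.3–4] -/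
theorem eq_sum_term19_connected {ρ : ℝ} (hρ : 1 < ρ) {U : Set ℂ} (hU : IsOpen U)
    (hsub : closedBall (0 : ℂ) ρ ⊆ U) {F : (Pt d → ℂ) → E} {R σ₀ : Finset (Pt d)} {a₀ : Pt d}
    (hR : WallConnected (↑R : Set (Pt d))) (ha₀ : a₀ ∈ R) (hF : SepHolNear F σ₀ U)
    (hsupp : SupportedOnRootComp F R σ₀ a₀) :
    F (setOne σ₀ 0) = ∑ σ ∈ σ₀.powerset with WallConnected (↑(R ∪ σ) : Set (Pt d)), term19 ρ F σ := by
  rw [eq_sum_term19 hρ hU hsub hF, sum_term19_eq_sum_connected ρ hR ha₀ hsupp]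

end End19

end

end Summit.QuantumFields.BalabanUV.Beta.DecouplingExpansion19
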